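import Summits.Parity.BatemanHorn.Theorems.RoughValueTransportBalancedSemiprimeLayerQuadraticSieveSequence
import HarnessLib

/-!
# Route `RoughValueTransport`, crux `BalancedSemiprimeLayer` (stmt-Parity-9469), line
# `rough-relaxed-divisor-sieve` (companion lead c1): the sieve step of the lever (anchor E)

The degree-blind lever `stub_roughWindowLever` of the skeleton
`Cruxes/BalancedSemiprimeLayer/Lines/rough_relaxed_divisor_sieve_c1.lean` sifts the weighted line
`n ↦ #{m ∈ roughDivWindow dᵢ δ c x : m ∣ fᵢ(n)}` (`n ∈ posRange f x`) by the primes `p < x^c`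
dividing `F(n) = ∏ⱼ fⱼ(n)`.  This file is its SIEVE STEP (registered anchor `stub_sifted_le`): the
pairs are booked at the value `F(n)` (`QuadraticSieve.pairSeq`, landed with the quadratic case), the
density is `ρ_F(d)/d` (`rootDensity`, dimension by `PolyPrimeCountBrun.hasSieveDimension_rootDensity_of_le`),
the size is `X = x·Σ_m ρᵢ(m)/m`, and the upper half of the PROVED uniform Fundamental Lemma
(`SieveSequence.fundamental_lemma_uniform_holds`, level `D = z = x^c`, `s = 1`) gives
`S ≤ (1 + C_FL)·X·V(x^c) + Σ_{d ∣ P(x^c), d ≤ x^c} |R_d|`; the remainders of the pair sequence ARE the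
window sums `Σ_m r(x; m, d)` of `windowPairRem` (`QuadraticSieve.congrSum_pairSeq`, `eval_prod`,
`polyRootCountMod_eq_single_prod`), and `{d ∣ P(x^c), d ≤ x^c} ⊆ {1 ≤ e ≤ ⌊x^c⌋, e squarefree}`.
No hypothesis on the degree of `fᵢ`; nothing is assumed beyond the tree.

References: H. Halberstam, H.-E. Richert, *Sieve Methods* (1974), Thm 2.5; J. Friedlander,
H. Iwaniec, *Opera de Cribro* (2010), Cor. 6.10 (both PROVED in the tree as used here).
-/

noncomputable section

open Polynomial Filter Finset
open Literature.NumberTheory.Sieve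
open scoped BigOperators

namespace Summit.Parity.BatemanHorn.Cruxes.BalancedSemiprimeLayer.RoughRelaxedDivisorSieve

open Summit.Parity.BatemanHorn.Cruxes.BalancedSemiprimeLayer.SmoothModulusTwistedHooley.QuadraticSieve
  (pairSeq congrSum_pairSeq sifted_pairSeq)


/-- On `posRange f x` the product `F(n) = (∏ⱼ fⱼ)(n) = ∏ⱼ fⱼ(n)` is positive. [folklore] -/
theorem eval_prod_pos_of_mem_posRange {k : ℕ} {f : Fin k → ℤ[X]} {x n : ℕ}
    (hn : n ∈ posRange f x) : 0 < (∏ j, f j).eval (n : ℤ) := by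
  unfold posRange at hn
  rw [mem_filter] at hn
  rw [Polynomial.eval_prod]
  exact Finset.prod_pos fun j _ => hn.2 j

/-- **The remainders of the pair sequence are the window sums of `windowPairRem`.**  For the pair
sequence of the line (pairs `(n, m)`, `n ∈ posRange f x`, `m ∈ roughDivWindow dᵢ δ c x`, `m ∣ fᵢ(n)`,
booked at `F(n)`; size `X = x·Σ_m ρᵢ(m)/m`; density `ρ_F(d)/d`) and any modulus `d`:
`R_d = Σ_{m} r(x; m, d)`. [folklore] -/
theorem remainder_pairSeq_eq_sum_windowPairRem {k : ℕ} (f : Fin k → ℤ[X]) (i : Fin k)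
    (δ c : ℝ) (x : ℕ) {xtop : ℝ}
    (hx : ∀ n ∈ posRange f x, 0 < (∏ j, f j).eval (n : ℤ) ∧
      (((∏ j, f j).eval (n : ℤ) : ℤ) : ℝ) ≤ xtop) (d : ℕ) :
    (pairSeq (f i) (∏ j, f j) (posRange f x) (roughDivWindow (f i).natDegree δ c x)
        ((x : ℝ) * ∑ m ∈ roughDivWindow (f i).natDegree δ c x, (polyRootCountMod ![f i] m : ℝ) / m)
        (rootDensity (∏ j, f j)) (isMultiplicative_rootDensity _)).remainder d xtop =
      ∑ m ∈ roughDivWindow (f i).natDegree δ c x, windowPairRem f i x m d := by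
  rw [SieveSequence.remainder, congrSum_pairSeq _ _ _ _ _ _ _ hx d]
  change _ - rootDensity (∏ j, f j) d * ((x : ℝ) * ∑ m ∈ roughDivWindow (f i).natDegree δ c x,
    (polyRootCountMod ![f i] m : ℝ) / m) = _
  rw [rootDensity_apply, ← PolyPrimeCountBrun.polyRootCountMod_eq_single_prod f d]
  unfold windowPairRem windowPairCount
  rw [Finset.sum_sub_distrib, Finset.mul_sum, Finset.mul_sum]
  congr 1
  · refine Finset.sum_congr rfl fun m _ => ?_
    congr 2
    refine Finset.filter_congr fun n _ => ?_
    rw [Polynomial.eval_prod]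
  · refine Finset.sum_congr rfl fun m _ => ?_
    ring

/-- **Anchor E `stub_sifted_le` — the sieve step of the lever** (registered sub-goal of the skeleton
`Cruxes/BalancedSemiprimeLayer/Lines/rough_relaxed_divisor_sieve_c1.lean`, through which this file
lands `--supports stmt-Parity-9469`).  For a Bateman–Horn system `f`
there is `C_FL ≥ 0` (the uniform Fundamental-Lemma constant at the dimension data of `F = ∏ⱼ fⱼ`,
depending on `f` only) such that for every coordinate `i`, all `c, δ > 0` and every `x` with `x^c ≥ 2`, the number `S` of pairs `(n, m)` with `n ∈ posRange f x`,
`m ∈ roughDivWindow dᵢ δ c x`, `m ∣ fᵢ(n)`, `(F(n), P(x^c)) = 1` satisfies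
`S ≤ (1 + C_FL)·(x·Σ_m ρᵢ(m)/m)·∏_{p < x^c}(1 − ρ_F(p)/p) + Σ_{1 ≤ e ≤ x^c, e sqfree} |Σ_m r(x; m, e)|`.
Proof: upper half of `fundamental_lemma_uniform_holds` for `pairSeq` at level `D = z = x^c`
(`e^{−1} ≤ 1`), `sifted_pairSeq`, `densityProduct` over `primeFactors P(z) = primesBelow ⌈z⌉`,
`remainder_pairSeq_eq_sum_windowPairRem`, and `{d ∣ P(z), d ≤ z} ⊆ {1 ≤ e ≤ ⌊z⌋, e squarefree}`.
[cite: FriedlanderIwaniecOpera2010, Cor. 6.10 (the fundamental lemma used, via the tree)] -/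
theorem stub_sifted_le :
    ∀ (k : ℕ) (f : Fin k → ℤ[X]), IsBatemanHornSystem f → ∃ CFL : ℝ, 0 ≤ CFL ∧
      ∀ (i : Fin k) (c δ : ℝ), 0 < c → 0 < δ → ∀ x : ℕ, (2 : ℝ) ≤ (x : ℝ) ^ c →
        (∑ m ∈ roughDivWindow (f i).natDegree δ c x,
            (#((posRange f x).filter (fun n : ℕ => ((m : ℤ) ∣ (f i).eval (n : ℤ)) ∧
                ((∏ j, f j).eval (n : ℤ)).natAbs.Coprime (primesProdBelow ((x : ℝ) ^ c)))) : ℝ)) ≤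
          (1 + CFL) * ((x : ℝ) * ∑ m ∈ roughDivWindow (f i).natDegree δ c x,
              (polyRootCountMod ![f i] m : ℝ) / m) *
            (∏ p ∈ Nat.primesBelow ⌈(x : ℝ) ^ c⌉₊, (1 - (polyRootCountMod f p : ℝ) / p)) +
          ∑ e ∈ (Icc 1 ⌊(x : ℝ) ^ c⌋₊).filter Squarefree,
            |∑ m ∈ roughDivWindow (f i).natDegree δ c x, windowPairRem f i x m e| := by
  intro k f hf
  -- ## dimension data of `F = ∏ⱼ fⱼ` (depends on `f` only)
  set F : ℤ[X] := ∏ j, f j with hFdef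
  have hρF : ∀ p, polyRootCountMod ![F] p = polyRootCountMod f p := fun p =>
    (PolyPrimeCountBrun.polyRootCountMod_eq_single_prod f p).symm
  have hρlt : ∀ p : ℕ, p.Prime → polyRootCountMod ![F] p < p := fun p hp => by
    rw [hρF]; exact hf.hasNoFixedPrimeDivisor p hp
  have hρle : ∀ p : ℕ, p.Prime → polyRootCountMod ![F] p ≤ ∑ j, (f j).natDegree :=
    fun p hp => (PolyPrimeCountBrun.polyRootCountMod_single_le_natDegree_of_lt hp (hρlt p hp)).trans
      (natDegree_prod_le _ _)
  have hdim := PolyPrimeCountBrun.hasSieveDimension_rootDensity_of_le hρle hρlt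
  obtain ⟨CFL, hCFL0, hFL⟩ := SieveSequence.fundamental_lemma_uniform_holds
    (2 * ((∑ j, (f j).natDegree : ℕ) : ℝ))
    ((((2 * ∑ j, (f j).natDegree + 1 : ℕ) : ℝ)) ^ (2 * ∑ j, (f j).natDegree + 1) *
      Real.exp (2 * ((∑ j, (f j).natDegree : ℕ) : ℝ) * (9 / 2 + 6 / Real.log 2)))
  refine ⟨CFL, hCFL0.le, fun i c δ _ _ x hxc => ?_⟩
  -- ## the pair sequence at height `x`
  set z : ℝ := (x : ℝ) ^ c with hz
  set R := posRange f x with hR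
  set M := roughDivWindow (f i).natDegree δ c x with hM
  set Xs : ℝ := (x : ℝ) * ∑ m ∈ M, (polyRootCountMod ![f i] m : ℝ) / m with hXs
  set 𝒜 := pairSeq (f i) F R M Xs (rootDensity F) (isMultiplicative_rootDensity F) with h𝒜
  set xtop : ℝ := ∑ n ∈ R, ((F.eval (n : ℤ) : ℤ) : ℝ) with hxtop
  have hx : ∀ n ∈ R, 0 < F.eval (n : ℤ) ∧ ((F.eval (n : ℤ) : ℤ) : ℝ) ≤ xtop := fun n hn =>
    ⟨eval_prod_pos_of_mem_posRange hn,
      Finset.single_le_sum (f := fun n : ℕ => ((F.eval (n : ℤ) : ℤ) : ℝ))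
        (fun m hm => by exact_mod_cast (eval_prod_pos_of_mem_posRange hm).le) hn⟩
  have hXs0 : 0 ≤ Xs :=
    mul_nonneg (Nat.cast_nonneg _) (Finset.sum_nonneg fun _ _ => by positivity)
  -- ## the Fundamental Lemma, upper half, level `D = z`
  have hdim' : HasSieveDimension 𝒜.density (2 * ((∑ j, (f j).natDegree : ℕ) : ℝ))
      ((((2 * ∑ j, (f j).natDegree + 1 : ℕ) : ℝ)) ^ (2 * ∑ j, (f j).natDegree + 1) *
        Real.exp (2 * ((∑ j, (f j).natDegree : ℕ) : ℝ) * (9 / 2 + 6 / Real.log 2))) := hdim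
  have hFLx := hFL 𝒜 hdim' xtop z z hxc le_rfl (show 0 ≤ 𝒜.size xtop from hXs0)
  have hsize : 𝒜.size xtop = Xs := rfl
  have hV : 𝒜.densityProduct (primesProdBelow z) =
      ∏ p ∈ Nat.primesBelow ⌈z⌉₊, (1 - (polyRootCountMod f p : ℝ) / p) := by
    rw [SieveSequence.densityProduct, primeFactors_primesProdBelow]
    refine Finset.prod_congr rfl fun p _ => ?_
    change 1 - rootDensity F p = _
    rw [rootDensity_apply, hρF]
  have hsift : 𝒜.sifted xtop (primesProdBelow z) =
      ∑ m ∈ M, (#(R.filter fun n : ℕ => (m : ℤ) ∣ (f i).eval (n : ℤ) ∧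
        (F.eval (n : ℤ)).natAbs.Coprime (primesProdBelow z)) : ℝ) :=
    sifted_pairSeq (f i) F R M Xs _ _ hx (primesProdBelow z)
  rw [hsize, hV, hsift] at hFLx
  set VG := ∏ p ∈ Nat.primesBelow ⌈z⌉₊, (1 - (polyRootCountMod f p : ℝ) / p) with hVG
  have hVG0 : 0 < VG := Finset.prod_pos fun p hp => by
    have h := (hdim.1 p (Nat.prime_of_mem_primesBelow hp)).2
    rw [rootDensity_apply, hρF] at h
    exact sub_pos.mpr h
  -- ## the remainder sum is dominated by the hypothesis' sum
  have hRsum : ∑ d ∈ (primesProdBelow z).divisors.filter (fun d : ℕ => (d : ℝ) ≤ z),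
      |𝒜.remainder d xtop| ≤
      ∑ e ∈ (Icc 1 ⌊z⌋₊).filter Squarefree, |∑ m ∈ M, windowPairRem f i x m e| := by
    have hrew : ∀ d, |𝒜.remainder d xtop| = |∑ m ∈ M, windowPairRem f i x m d| := fun d => by
      rw [h𝒜, hXs, hM, hR, hFdef, remainder_pairSeq_eq_sum_windowPairRem f i δ c x hx d]
    simp_rw [hrew]
    refine Finset.sum_le_sum_of_subset_of_nonneg (fun d hd => ?_) (fun _ _ _ => abs_nonneg _)
    rw [Finset.mem_filter, Nat.mem_divisors] at hd
    rw [Finset.mem_filter, Finset.mem_Icc]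
    exact ⟨⟨Nat.pos_of_dvd_of_pos hd.1.1 (Nat.pos_of_ne_zero hd.1.2), Nat.le_floor hd.2⟩,
      (squarefree_primesProdBelow z).squarefree_of_dvd hd.1.1⟩
  -- ## assemble
  have hexp : Real.exp (-(Real.log z / Real.log z)) ≤ 1 := by
    rw [Real.exp_le_one_iff, neg_nonpos]
    exact div_nonneg (Real.log_nonneg (by linarith)) (Real.log_nonneg (by linarith))
  have hmain : CFL * Xs * VG * Real.exp (-(Real.log z / Real.log z)) ≤ CFL * Xs * VG :=
    mul_le_of_le_one_right (by positivity) hexp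
  have hab := (abs_le.mp hFLx).2
  change ∑ m ∈ M, (#(R.filter fun n : ℕ => (m : ℤ) ∣ (f i).eval (n : ℤ) ∧
      (F.eval (n : ℤ)).natAbs.Coprime (primesProdBelow z)) : ℝ) ≤
    (1 + CFL) * Xs * VG + ∑ e ∈ (Icc 1 ⌊z⌋₊).filter Squarefree, |∑ m ∈ M, windowPairRem f i x m e|
  nlinarith [hab, hRsum, hmain]

end Summit.Parity.BatemanHorn.Cruxes.BalancedSemiprimeLayer.RoughRelaxedDivisorSieve
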